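import Summits.AnomalousDissipation.AnomalousDissipation.Theses.DopplerClock
import Literature.Analysis.FunctionSpaces.TorusTrigPoly

/-!
# `DopplerClock.ForceAdmissible` (stmt-AnomalousDissipation-18131): the swept Doppler pair is an
admissible force

Route `AnomalousDissipation/DopplerClock`, support item `ForceAdmissible`: for ALL `F : ℝ`, `m n : ℕ` the
steady force
`f(x) = F · Im e_{(0,m,0)}(x) · Re e_{(0,0,n)}(x) · e₀ = F sin(2πm x₁) cos(2πn x₂) e₀`
on `T³` is smooth, divergence free and has zero mean (the three admissibility clauses of the summit
statement `AnomalousDissipation`, consumed by the route's `closes`). No hypothesis on `m`, `n` is needed: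
`m = 0` gives the zero field.

Proof (stated for general frequencies `k l : ℤ³`, then specialised to `k = (0,m,0)`, `l = (0,0,n)`):

* smooth — `Re`, `Im` of the characters `e_k` are smooth (`Torus.isSmooth_mFourier`), products and
  the constant direction `e₀` preserve smoothness;
* divergence free when `k₀ = l₀ = 0` — along every coordinate line `t ↦ x + t eᵢ` the `i`-th
  component of `f` is constant (`i ≠ 0`: it vanishes; `i = 0`: `e_k(x + t e₀) = e_k(x) e^{2πi k₀ t} =
  e_k(x)` by `Torus.mFourier_apply_add`, `Torus.mFourier_proj_smul_single`), so every `∂ᵢ fᵢ = 0`;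
* mean zero for all `k l` — product-to-sum `Im e_k · Re e_l = (Im e_{k+l} + Im e_{k-l})/2` and
  `∫ e_K ∈ {0, 1}` (`Torus.integral_mFourier`) has vanishing imaginary part.

Source: folklore (Foias–Manley–Rosa–Temam 2001, Ch. II §2: Fourier characters on the periodic box are
smooth, and a single-component field independent of its own coordinate is solenoidal).
-/

-- `Summit.<Summit>.<Problem>` is the tree's mandated summit-side namespace (CONVENTIONS §2); for this
-- single-conjunct summit the two coincide, so the duplicate is deliberate (lakefile: off for `Summits`).
set_option linter.dupNamespace false

noncomputable section

open MeasureTheory UnitAddTorus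
open Literature.Analysis.FunctionSpaces

namespace Summit.AnomalousDissipation.AnomalousDissipation.Theorems

/-- Smoothness: for any frequencies `k l : ℤ³` and amplitude `F`, the field
`x ↦ (F · Im e_k(x) · Re e_l(x)) e₀` is smooth on `T³` (characters are smooth, `Re`/`Im` are real-linear
and continuous, products of smooth scalars are smooth). [folklore] -/
theorem dopplerForce_isSmooth (F : ℝ) (k l : Fin 3 → ℤ) :
    Torus.IsSmooth (fun x : UnitAddTorus (Fin 3) =>
      (F * (mFourier k x).im * (mFourier l x).re) • EuclideanSpace.single (0 : Fin 3) (1 : ℝ)) := by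
  have hk : Torus.IsSmooth (fun x : UnitAddTorus (Fin 3) => (mFourier k x).im) :=
    (Torus.isSmooth_mFourier k).comp_clm Complex.imCLM
  have hl : Torus.IsSmooth (fun x : UnitAddTorus (Fin 3) => (mFourier l x).re) :=
    (Torus.isSmooth_mFourier l).comp_clm Complex.reCLM
  have hθ : Torus.IsSmooth
      (fun x : UnitAddTorus (Fin 3) => F * (mFourier k x).im * (mFourier l x).re) := by
    unfold Torus.IsSmooth at hk hl ⊢
    exact (contDiff_const.mul hk).mul hl
  exact hθ.smul' (Torus.isSmooth_const _)

/-- A character whose frequency has no `0`-component is invariant under translation along `e₀`: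
`e_k(x + t e₀) = e_k(x) e^{2πi k₀ t} = e_k(x)` when `k₀ = 0`. [folklore] -/
theorem mFourier_add_proj_smul_single_zero {k : Fin 3 → ℤ} (hk : k 0 = 0)
    (x : UnitAddTorus (Fin 3)) (t : ℝ) :
    mFourier k (x + Torus.proj (t • EuclideanSpace.single (0 : Fin 3) (1 : ℝ))) = mFourier k x := by
  rw [Torus.mFourier_apply_add, Torus.mFourier_proj_smul_single, hk, fourier_zero, mul_one]

/-- A vector field on `T³` each of whose components `uᵢ` is constant along its own coordinate lines
`t ↦ x + t eᵢ` is divergence free: every `∂ᵢ uᵢ` is the derivative of a constant. [folklore] -/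
theorem isDivFree_of_apply_line_const {u : UnitAddTorus (Fin 3) → EuclideanSpace ℝ (Fin 3)}
    (h : ∀ (i : Fin 3) (x : UnitAddTorus (Fin 3)) (t : ℝ),
      u (x + Torus.proj (t • EuclideanSpace.single i (1 : ℝ))) i = u x i) :
    Torus.IsDivFree u := by
  intro x
  unfold Torus.divergence Torus.partialDeriv Torus.lineDeriv
  refine Finset.sum_eq_zero fun i _ => ?_
  simp only [h, deriv_const]

/-- Incompressibility: if `k₀ = l₀ = 0` the field `x ↦ (F · Im e_k(x) · Re e_l(x)) e₀` is divergence
free — its only nonzero component is the `0`-th, which does not depend on `x₀`. [folklore] -/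
theorem dopplerForce_isDivFree (F : ℝ) {k l : Fin 3 → ℤ} (hk : k 0 = 0) (hl : l 0 = 0) :
    Torus.IsDivFree (fun x : UnitAddTorus (Fin 3) =>
      (F * (mFourier k x).im * (mFourier l x).re) • EuclideanSpace.single (0 : Fin 3) (1 : ℝ)) := by
  refine isDivFree_of_apply_line_const fun i x t => ?_
  by_cases hi : i = 0
  · subst hi
    simp only [mFourier_add_proj_smul_single_zero hk, mFourier_add_proj_smul_single_zero hl]
  · simp [hi]

/-- Product-to-sum for characters: `Im e_k(x) · Re e_l(x) = (Im e_{k+l}(x) + Im e_{k-l}(x)) / 2`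
(`e_{k+l} = e_k e_l`, `e_{-l} = conj e_l`). [folklore] -/
theorem im_mFourier_mul_re_mFourier (k l : Fin 3 → ℤ) (x : UnitAddTorus (Fin 3)) :
    (mFourier k x).im * (mFourier l x).re =
      ((mFourier (k + l) x).im + (mFourier (k - l) x).im) / 2 := by
  rw [sub_eq_add_neg, mFourier_add, mFourier_add, mFourier_neg]
  simp only [Complex.mul_im, Complex.conj_re, Complex.conj_im]
  ring

/-- The imaginary part of a character integrates to zero over `T³`: `∫ e_K ∈ {0, 1}`
(`Torus.integral_mFourier`), whose imaginary part vanishes in both cases. [folklore] -/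
theorem integral_im_mFourier (K : Fin 3 → ℤ) :
    ∫ x : UnitAddTorus (Fin 3), (mFourier K x).im = 0 := by
  have hint : Integrable (⇑(mFourier K) : UnitAddTorus (Fin 3) → ℂ) volume :=
    (mFourier K).continuous.integrable_unitAddTorus
  have h := Complex.imCLM.integral_comp_comm hint
  simp only [Complex.imCLM_apply] at h
  rw [h, Torus.integral_mFourier]
  split_ifs <;> simp

/-- Zero mean: for any frequencies `k l : ℤ³` and amplitude `F`, `∫ (F · Im e_k · Re e_l) e₀ = 0`
(product-to-sum and `∫ Im e_K = 0`). [folklore] -/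
theorem dopplerForce_hasZeroMean (F : ℝ) (k l : Fin 3 → ℤ) :
    Torus.HasZeroMean (fun x : UnitAddTorus (Fin 3) =>
      (F * (mFourier k x).im * (mFourier l x).re) • EuclideanSpace.single (0 : Fin 3) (1 : ℝ)) := by
  have hi : ∀ K : Fin 3 → ℤ, Integrable (fun x : UnitAddTorus (Fin 3) => (mFourier K x).im) volume :=
    fun K => (Complex.continuous_im.comp (mFourier K).continuous).integrable_unitAddTorus
  have h1 : ∀ x : UnitAddTorus (Fin 3), F * (mFourier k x).im * (mFourier l x).re =
      F / 2 * ((mFourier (k + l) x).im + (mFourier (k - l) x).im) := by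
    intro x
    rw [mul_assoc, im_mFourier_mul_re_mFourier]
    ring
  have hθ : ∫ x : UnitAddTorus (Fin 3), F * (mFourier k x).im * (mFourier l x).re = 0 := by
    simp_rw [h1]
    rw [integral_const_mul, integral_add (hi (k + l)) (hi (k - l)), integral_im_mFourier,
      integral_im_mFourier, add_zero, mul_zero]
  show ∫ x : UnitAddTorus (Fin 3),
      (F * (mFourier k x).im * (mFourier l x).re) • EuclideanSpace.single (0 : Fin 3) (1 : ℝ) = 0
  rw [integral_smul_const, hθ, zero_smul]

/-- **`DopplerClock.ForceAdmissible`** (stmt-AnomalousDissipation-18131): for all `F : ℝ`, `m n : ℕ`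
the swept Doppler pair `f(x) = F sin(2πm x₁) cos(2πn x₂) e₀ = (F · Im e_{(0,m,0)}(x) · Re e_{(0,0,n)}(x)) e₀`
is smooth, divergence free and mean zero on `T³` — the route decl BY NAME, from the three lemmas above
at `k = (0,m,0)`, `l = (0,0,n)` (both with vanishing `0`-component). [folklore] -/
theorem dopplerClock_forceAdmissible_proof :
    Summit.AnomalousDissipation.AnomalousDissipation.Theses.DopplerClock.ForceAdmissible := by
  intro F m n
  have h1 : (Pi.single (1 : Fin 3) (m : ℤ) : Fin 3 → ℤ) 0 = 0 := Pi.single_eq_of_ne (by decide) _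
  have h2 : (Pi.single (2 : Fin 3) (n : ℤ) : Fin 3 → ℤ) 0 = 0 := Pi.single_eq_of_ne (by decide) _
  exact ⟨dopplerForce_isSmooth F _ _, dopplerForce_isDivFree F h1 h2, dopplerForce_hasZeroMean F _ _⟩

end Summit.AnomalousDissipation.AnomalousDissipation.Theorems

end
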